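import Summits.QuantumFields.BalabanUV.T4Continuum.Support.NE3EnergyWeightedShapes
import HarnessLib

/-!
# T⁴ programme, node NE3 — THE COVARIANT ROOT `NE3EnergyRateWCov`: T-E_w with the two COVARIANT regular-gauge conjuncts
# (Lip₁ᶜ) (first covariant differences of the discrepancy direction `≤ Λ₁·ξ²`) and (Lip₂′ᶜ) (second covariant differences `≤ Λ₂′·ξ³`),
# typed VERBATIM as INTERFACE REQUEST NE7→NE3 amendment 4 (WAKE-1) words it — statement-first; a hypothesis SHAPE, asserted for nothing
# except the flat datum

Cell `pub-balaban-gaps` (YM blitz, track G2, seat `ne3`, unit `pub-balaban-gaps-ne3`; writer prover-pub-balaban-gaps-ne3-g0-0, 2026-08-22),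
typing the STANDING charge of `run/shared/lean/pub/pub-balaban/WAKE/WAKE-b2b-balaban-t4-ne3-p1.md` amendment 4 (sha16 15cc37d03ae46b1d,
dagwriter g12, 2026-08-21T07:5xZ; «no taker» through T4-DAG v91, 2026-08-22T17:11Z; X-A4 re-seat never minted) on behalf of the PARKED row-NE3
owner lineage `b2b-balaban-t4-ne3-p1` (author of `NE3EnergyWeightedShapes`, where the base shape `NE3EnergyRateW` lives).  Requester: the NE7 crux
prover `b2b-balaban-t4-ne7-p1` (gen 23, HOME/INBOX.md l.4001–4006; kernel consumer `NE7EtaCurlFromCovGradient.closeness_of_covRoot₂` p254713, whose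
hypothesis `h` IS this shape unfolded at `d = 4`).

WHAT (all `[folklore]`: one parametric `def … : Prop` + bookkeeping one-liners):
* **`NE3EnergyRateWCov d 𝒞 L N b g C Λ₁ Λ₂' dom`** — VERBATIM `NE3EnergyWeightedShapes.NE3EnergyRateW d 𝒞 L N b g C dom` (T-E_w: for every level
  `k ≥ 1`, datum `V ∈ dom`, minimiser `UA` of the `k`-step run and `(b, g)`-regular minimiser `UB` of the `(k+1)`-step run there are a unitary
  `(N·L^k)`-periodic site gauge `u` and a skew `(N·L^k)`-periodic direction `Z` with `gaugeAct u UA = vary W Z 1`, `W := rescale L (bavg L UB)`, and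
  `energyNormW L k W Z (periodBox (N·L^k)) ≤ C·residualScale d L N b g k`) with TWO MORE CONJUNCTS inside the `∃ (u, Z)`, `ξ := ((L:ℝ)⁻¹)^k`,
  `Ad` = `T4AveragingDeficitWall.Ad`:
  (Lip₁ᶜ)  `∀ κ x μ, ‖Ad (W (x + e κ) μ) (Z (x + e μ) κ) − Z x κ‖ ≤ Λ₁·ξ^2`;
  (Lip₂′ᶜ) `∀ κ μ y, ‖Ad (W (y + e κ) μ) (Ad (W (y + e κ + e μ) μ) (Z (y + 2•e μ) κ) − Z (y + e μ) κ) − (Ad (W (y + e κ) μ) (Z (y + e μ) κ) − Z y κ)‖ ≤ Λ₂′·ξ^3`.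
  (`Z` sits at the END of its bond under `vary W Z 1 = W·e^Z`, hence the transport `W (x + e κ) μ`; both conjuncts are invariant under
  `(u, W, Z) ↦ (w·u, gaugeAct w W, dirGauge w Z)` — `NE7EtaRegauging.covariantData_regauge` — so the root may be PROVED in any gauge of `W`.)
* `ne3EnergyRateW_of_cov` : `NE3EnergyRateWCov … C Λ₁ Λ₂' dom → NE3EnergyRateW … C dom` (drop the two conjuncts; the base root verbatim).
* `NE3EnergyRateWCov.mono` : monotone in `C`, `Λ₁`, `Λ₂'`.
* `ne3EnergyRateWCov_flat` : NON-VACUITY on the flat class with the flat datum (`u = 1`, `Z = 0`; every `C, Λ₁, Λ₂' ≥ 0`).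
* `NE3EnergyRateWCov.perPair` : the shape applied at one level∕datum∕pair (the `∃`-body, for consumers that destructure it).
The consumer-side END at `d = 4` is obtained BY NAME: `NE7EtaCurlFromCovGradient.closeness_of_covRoot₂ … (h := hcov) …` for
`hcov : NE3EnergyRateWCov 4 𝒞 L N b g C Λ₁ Λ₂' dom` (definitional unfolding; no adapter needed).

PRINTED LOCI OF THE TYPE (as printed; NOTHING below is a hypothesis of a theorem here).  The two conjuncts are the REGULAR-GAUGE TYPE of
[Balaban1985RegularSpaces] (B8 = CMP 99 (1985) 75–102) Theorem 2 p. 83 with (1.36) p. 82 «∣A∣ < B₁(α₀+α₁)(Lʲη)⁻¹, ∣∇^η_{U₀}A∣ < B₁(α₀+α₁)(Lʲη)⁻², …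
on Ω_j» and (1.39) p. 83 «∣D^{η*}_{U₀}D^η_{U₀}A∣, ∣Δ^η_{U₀}A∣ < B₁(α₀+α₁)(Lʲη)⁻³ on Ω_j» for the Landau representative `U₁ = U′^{u⁻¹} = e^{iηA}` of a
regular configuration `U′U₀` RELATIVE TO a regular background `U₀` (hypotheses (1.33)–(1.35) p. 82), read at the pair `U₀ := W = rescale L (bavg L UB)`,
`U′U₀ := UA` (both in `𝔅_k(𝔅_k, V)`, so (1.35) holds for every `α₁ > 0`: p. 82 «It is satisfied if V is close to Ū₀ʲ, more precisely if ∣V − Ū₀ʲ∣ < α₁»);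
and of [Balaban1985Variational] (B11 = CMP 102 (1985) 277–309) Theorem 1 (9)–(10) p. 279 for each minimiser separately.  CAVEAT recorded by this
seat: (1.36)∕(1.39) and (9)∕(10) print sup bounds on `∇A`, on the β-Hölder quotient of `∇A` (β ≤ β₀ < 1) and on `Δ A`, `D*DA` — NOT on a pure second
covariant difference; (Lip₂′ᶜ) as worded by the requester is the B12 [Balaban1987RG1] (1.12)–(1.13) p. 262 regular-gauge TYPE.  The ENERGY conjunct
with a RATE is NE3 proper: NOT PRINTED anywhere in B1–B16 (cell census `t4/T4-XREAD-U1b.md` §3; printed template = C. King, CMP 102 (1986) Prop. 3.8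
(3.71) p. 664, abelian).

HONEST FRAMING.  A typed hypothesis SHAPE discharges nothing: `theorem ne3EnergyRateWCov : NE3EnergyRateWCov 4 (sfClass 4 L N ε) L N b g C Λ₁ Λ₂' dom`
for Bałaban's minimisers is row NE3's spine estimate (re-typed, covariant) and is NOT proved here or anywhere; the END of record of the row
(`NE3EnergyRateWSupRoutePiRInv.ne3EnergyRateWSup_sfClass_routePi_rinv`, p247216) concludes the WEAKER face T-E_w♯ and is itself CONDITIONAL on per-pair
leaves.  NE3 and NE7 NOT proved; spine PROVED 0∕9; finite T⁴ rung (B)+1 — NOT infinite volume, NOT mass gap, NOT `BetaPertH`, NOT Clay.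
HONEST DEPENDENCY: continuum YM on T⁴ ⇐ BetaPertH ∧ nine spine estimates (0/9 proved); BetaPertH ⇐ (D1) ∧ (D4) ∧ CAP+tail; G-an2-4 gates asym, D1 and
NE2/3/4.  PLACEMENT: `Summits/QuantumFields/BalabanUV/T4Continuum/Support/` next to `NE3EnergyWeightedShapes` (WAKE-1 «charge_now»).
-/

set_option autoImplicit false

open scoped BigOperators Matrix Matrix.Norms.L2Operator
open Finset

namespace Summit.QuantumFields.BalabanUV.T4Continuum.NE3EnergyWeightedCovShape

open Literature.MathematicalPhysics.QuantumFieldTheory.Balaban1983to89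
open B7Prop1Explicit B7Prop2Explicit
open T4AveragingDeficitWall hiding Site Plane Plaq Bond
open T4AveragingDeficitWallBoundary (IsPeriodicCfg periodBox)
open AveragingDeficitPeriodicCounting (IsPeriodicDir)
open MinimalActionSandwich (IsMinimiser)
open MinimalActionRate (Regular)
open MinimalActionWitness (flatCfg flatClass)
open NE3EnergyShapes (residualScale residualScale_nonneg IsUnitarySite IsPeriodicSite gaugeAct_one rescale_bavg_flatCfg)
open NE3EnergyWeightedShapes (energyNormW energyNormW_nonneg energyNormW_zero NE3EnergyRateW)

noncomputable section

variable {d : ℕ} {n : Type*} [Fintype n] [DecidableEq n]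

/-! ## §1 The covariant root -/

variable (d) in
/-- **T-E_w^cov — NE3 IN THE η-WEIGHTED ENERGY-DISTANCE READING WITH THE TWO COVARIANT REGULAR-GAUGE CONJUNCTS** (a `Prop`; asserted for no class
here except the flat one below): VERBATIM `NE3EnergyWeightedShapes.NE3EnergyRateW d 𝒞 L N b g C dom` with, inside the `∃ (u, Z)` and for
`W := rescale L (bavg L UB)`, `ξ := ((L:ℝ)⁻¹)^k`: (Lip₁ᶜ) `∀ κ x μ, ‖Ad (W (x + e κ) μ) (Z (x + e μ) κ) − Z x κ‖ ≤ Λ₁·ξ²` and (Lip₂′ᶜ)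
`∀ κ μ y, ‖Ad (W (y+e κ) μ) (Ad (W (y+e κ+e μ) μ) (Z (y+2•e μ) κ) − Z (y+e μ) κ) − (Ad (W (y+e κ) μ) (Z (y+e μ) κ) − Z y κ)‖ ≤ Λ₂′·ξ³` — the words of
INTERFACE REQUEST NE7→NE3 amendment 4 (WAKE-1).  Regular-gauge TYPE: [Balaban1985RegularSpaces] Thm 2 (1.36)∕(1.39) pp. 82–83 at the pair
`(U₀, U′U₀) := (W, UA)`; the energy conjunct with a rate is NOT PRINTED.  A hypothesis∕target SHAPE. [folklore] -/
@[folklore]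
def NE3EnergyRateWCov (𝒞 : ℕ → Set (Site d → Fin d → (Matrix n n ℂ)ˣ)) (L N : ℕ) (b g C Λ₁ Λ₂' : ℝ)
    (dom : Set (Site d → Fin d → (Matrix n n ℂ)ˣ)) : Prop :=
  ∀ k : ℕ, 1 ≤ k → ∀ V ∈ dom, ∀ UA UB : Site d → Fin d → (Matrix n n ℂ)ˣ,
    IsMinimiser d 𝒞 L N k V UA → IsMinimiser d 𝒞 L N (k + 1) V UB → Regular d L N b g (k + 1) UB →
      ∃ (u : Site d → (Matrix n n ℂ)ˣ) (Z : Site d → Fin d → Matrix n n ℂ),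
        IsUnitarySite u ∧ IsPeriodicSite u ((N * L ^ k : ℕ) : ℤ) ∧
        IsSkewDir Z ∧ IsPeriodicDir Z ((N * L ^ k : ℕ) : ℤ) ∧
        gaugeAct u UA = vary (rescale L (bavg L UB)) Z 1 ∧
        energyNormW L k (rescale L (bavg L UB)) Z (periodBox (N * L ^ k)) ≤ C * residualScale d L N b g k ∧
        (∀ (κ : Fin d) (x : Site d) (μ : Fin d),
          ‖Ad (rescale L (bavg L UB) (x + e κ) μ) (Z (x + e μ) κ) - Z x κ‖ ≤ Λ₁ * (((L : ℝ)⁻¹) ^ k) ^ 2) ∧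
        (∀ (κ μ : Fin d) (y : Site d),
          ‖Ad (rescale L (bavg L UB) (y + e κ) μ)
              (Ad (rescale L (bavg L UB) (y + e κ + e μ) μ) (Z (y + (2 : ℕ) • e μ) κ) - Z (y + e μ) κ)
            - (Ad (rescale L (bavg L UB) (y + e κ) μ) (Z (y + e μ) κ) - Z y κ)‖ ≤ Λ₂' * (((L : ℝ)⁻¹) ^ k) ^ 3)

/-! ## §2 Bookkeeping: projection to the base root, monotonicity, the per-pair body -/

/-- **T-E_w^cov ⇒ T-E_w**: dropping the two covariant conjuncts recovers `NE3EnergyWeightedShapes.NE3EnergyRateW` verbatim. [folklore] -/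
theorem ne3EnergyRateW_of_cov {𝒞 : ℕ → Set (Site d → Fin d → (Matrix n n ℂ)ˣ)} {L N : ℕ} {b g C Λ₁ Λ₂' : ℝ}
    {dom : Set (Site d → Fin d → (Matrix n n ℂ)ˣ)} (h : NE3EnergyRateWCov d 𝒞 L N b g C Λ₁ Λ₂' dom) :
    NE3EnergyRateW d 𝒞 L N b g C dom := by
  intro k hk V hV UA UB hA hB hreg
  obtain ⟨u, Z, hu, huP, hZ, hZP, hrep, hE, -, -⟩ := h k hk V hV UA UB hA hB hreg
  exact ⟨u, Z, hu, huP, hZ, hZP, hrep, hE⟩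

/-- T-E_w^cov is monotone in the three constants `C ≤ C′`, `Λ₁ ≤ Λ₁′`, `Λ₂′ ≤ Λ₂″` (the residual scale and `ξ = ((L:ℝ)⁻¹)^k` are non-negative).
[folklore] -/
theorem NE3EnergyRateWCov.mono {𝒞 : ℕ → Set (Site d → Fin d → (Matrix n n ℂ)ˣ)} {L N : ℕ} {b g C C' Λ₁ Λ₁' Λ₂' Λ₂'' : ℝ}
    {dom : Set (Site d → Fin d → (Matrix n n ℂ)ˣ)} (h : NE3EnergyRateWCov d 𝒞 L N b g C Λ₁ Λ₂' dom) (hC : C ≤ C') (hΛ₁ : Λ₁ ≤ Λ₁')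
    (hΛ₂ : Λ₂' ≤ Λ₂'') : NE3EnergyRateWCov d 𝒞 L N b g C' Λ₁' Λ₂'' dom := by
  intro k hk V hV UA UB hA hB hreg
  obtain ⟨u, Z, hu, huP, hZ, hZP, hrep, hE, h1, h2⟩ := h k hk V hV UA UB hA hB hreg
  have hξ : 0 ≤ ((L : ℝ)⁻¹) ^ k := pow_nonneg (inv_nonneg.mpr (Nat.cast_nonneg L)) k
  refine ⟨u, Z, hu, huP, hZ, hZP, hrep, hE.trans ?_, fun κ x μ => (h1 κ x μ).trans ?_, fun κ μ y => (h2 κ μ y).trans ?_⟩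
  · exact mul_le_mul_of_nonneg_right hC (residualScale_nonneg d L N b g k)
  · exact mul_le_mul_of_nonneg_right hΛ₁ (pow_nonneg hξ 2)
  · exact mul_le_mul_of_nonneg_right hΛ₂ (pow_nonneg hξ 3)

/-- The per-pair body of T-E_w^cov (for consumers that destructure one level ∕ datum ∕ minimiser pair). [folklore] -/
theorem NE3EnergyRateWCov.perPair {𝒞 : ℕ → Set (Site d → Fin d → (Matrix n n ℂ)ˣ)} {L N : ℕ} {b g C Λ₁ Λ₂' : ℝ}
    {dom : Set (Site d → Fin d → (Matrix n n ℂ)ˣ)} (h : NE3EnergyRateWCov d 𝒞 L N b g C Λ₁ Λ₂' dom)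
    {k : ℕ} (hk : 1 ≤ k) {V : Site d → Fin d → (Matrix n n ℂ)ˣ} (hV : V ∈ dom) {UA UB : Site d → Fin d → (Matrix n n ℂ)ˣ}
    (hA : IsMinimiser d 𝒞 L N k V UA) (hB : IsMinimiser d 𝒞 L N (k + 1) V UB) (hreg : Regular d L N b g (k + 1) UB) :
    ∃ (u : Site d → (Matrix n n ℂ)ˣ) (Z : Site d → Fin d → Matrix n n ℂ),
      IsUnitarySite u ∧ IsPeriodicSite u ((N * L ^ k : ℕ) : ℤ) ∧
      IsSkewDir Z ∧ IsPeriodicDir Z ((N * L ^ k : ℕ) : ℤ) ∧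
      gaugeAct u UA = vary (rescale L (bavg L UB)) Z 1 ∧
      energyNormW L k (rescale L (bavg L UB)) Z (periodBox (N * L ^ k)) ≤ C * residualScale d L N b g k ∧
      (∀ (κ : Fin d) (x : Site d) (μ : Fin d),
        ‖Ad (rescale L (bavg L UB) (x + e κ) μ) (Z (x + e μ) κ) - Z x κ‖ ≤ Λ₁ * (((L : ℝ)⁻¹) ^ k) ^ 2) ∧
      (∀ (κ μ : Fin d) (y : Site d),
        ‖Ad (rescale L (bavg L UB) (y + e κ) μ)
            (Ad (rescale L (bavg L UB) (y + e κ + e μ) μ) (Z (y + (2 : ℕ) • e μ) κ) - Z (y + e μ) κ)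
          - (Ad (rescale L (bavg L UB) (y + e κ) μ) (Z (y + e μ) κ) - Z y κ)‖ ≤ Λ₂' * (((L : ℝ)⁻¹) ^ k) ^ 3) :=
  h k hk V hV UA UB hA hB hreg

/-! ## §3 Non-vacuity on the flat datum -/

/-- NON-VACUITY: in the flat class with the flat datum T-E_w^cov holds for every `C, Λ₁, Λ₂' ≥ 0` (both minimisers flat, `u = 1`, `Z = 0`: every
covariant difference of the zero direction vanishes). [folklore] -/
theorem ne3EnergyRateWCov_flat [Nonempty n] (L N : ℕ) (b g : ℝ) {C Λ₁ Λ₂' : ℝ} (hC : 0 ≤ C) (hΛ₁ : 0 ≤ Λ₁) (hΛ₂ : 0 ≤ Λ₂') :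
    NE3EnergyRateWCov d (flatClass (n := n)) L N b g C Λ₁ Λ₂' {flatCfg} := by
  intro k _ V _ UA UB hA hB _
  have hUA : UA = flatCfg := by simpa [flatClass, MinimalActionSandwich.admissible] using hA.mem.1
  have hUB : UB = flatCfg := by simpa [flatClass, MinimalActionSandwich.admissible] using hB.mem.1
  have hξ : 0 ≤ ((L : ℝ)⁻¹) ^ k := pow_nonneg (inv_nonneg.mpr (Nat.cast_nonneg L)) k
  refine ⟨fun _ => 1, fun (_ : Site d) (_ : Fin d) => (0 : Matrix n n ℂ), fun _ => (unitaryUnits _).one_mem,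
    fun _ _ => rfl, fun _ _ => (skewAdjoint _).zero_mem, fun _ _ _ => rfl, ?_, ?_, ?_, ?_⟩
  · rw [hUA, hUB, rescale_bavg_flatCfg, gaugeAct_one, vary_zero_dir]
  · rw [energyNormW_zero]
    exact mul_nonneg hC (residualScale_nonneg d L N b g k)
  · intro κ x μ
    simp only [Ad, mul_zero, zero_mul, sub_zero, norm_zero]
    exact mul_nonneg hΛ₁ (pow_nonneg hξ 2)
  · intro κ μ y
    simp only [Ad, mul_zero, zero_mul, sub_zero, norm_zero]
    exact mul_nonneg hΛ₂ (pow_nonneg hξ 3)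

end

end Summit.QuantumFields.BalabanUV.T4Continuum.NE3EnergyWeightedCovShape
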